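import Literature.NumberTheory.EllipticCurves.HeightFamily
import HarnessLib

/-!
# Runbook sanity lemmas — the height family and height densities (REVIEW-RUNBOOK cards of `pub-bsdpct`)

Mechanical companions of the definition cards of `REVIEW-RUNBOOK.md` for
`heightDensityGE_rankLeOne_and_fullBSDOffSgoPrime_cRank_of_sieve` (cell `pub-bsdpct`), generated by
`harness/kit/review_runbook.py` (ops-runbook seat, human idea 2026-08-19):

* (b) NON-VACUITY of the height family `𝓕`: `(0, 1)` (the curve `y² = x³ + 1`) is in the family and has
  naive height `27`; `(0, 0)` (the cusp `y² = x³`) is not.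
* (b) NON-VACUITY / NON-TRIVIALITY of the density predicate `HeightDensityGE P δ`: it HOLDS for every
  property at `δ = 0` and FAILS for the empty property at every `δ > 0` (so the conclusion of the reviewed
  theorem is not a tautology of the shape of the predicate).
* (a) the proportion of the ALWAYS-TRUE property is `1` as soon as the family below `X` is non-empty, and
  the proportion of the empty property is `0` (agreement with the intended reading "share of curves").

Nothing here is used by the theorem under review; these are reader-facing checks.
-/

namespace Summit.BirchSwinnertonDyer.BSDPercentage.Runbook

open Literature.NumberTheory.EllipticCurves Filter

/-- (b) The pair `(A, B) = (0, 1)`, i.e. the curve `y² = x³ + 1`, lies in the height family `𝓕`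
(`4·0³ + 27·1² = 27 ≠ 0`, and no `p⁶` divides `1`). -/
theorem isInHeightFamily_zero_one : IsInHeightFamily (0, 1) := by
  refine ⟨by norm_num, fun p hp h => ?_⟩
  have h6 : ((p : ℤ) ^ 6 ∣ 1) := h.2
  have hp1 : (p : ℤ) ^ 6 = 1 ∨ (p : ℤ) ^ 6 = -1 := by
    rcases Int.isUnit_iff.mp (isUnit_of_dvd_one h6) with h | h <;> simp [h]
  have hp2 : 2 ≤ (p : ℤ) := by exact_mod_cast hp.two_le
  have : (2 : ℤ) ^ 6 ≤ (p : ℤ) ^ 6 := pow_le_pow_left₀ (by norm_num) hp2 6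
  rcases hp1 with h | h <;> linarith

/-- (b) The pair `(0, 0)` (the cuspidal cubic `y² = x³`) is NOT in the family: its discriminant
quantity `4A³ + 27B²` vanishes. -/
theorem not_isInHeightFamily_zero_zero : ¬ IsInHeightFamily (0, 0) := by
  intro h
  exact h.1 (by norm_num)

/-- (b) The naive height of `(0, 1)` is `max (4·0³) (27·1²) = 27`. -/
theorem naiveHeight_zero_one : naiveHeight (0, 1) = 27 := by
  simp [naiveHeight]

/-- (a) The proportion of the EMPTY property is `0` for every height bound. -/
theorem heightProportion_false (X : ℕ) : heightProportion (fun _ => False) X = 0 := by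
  simp [heightProportion, heightAverage]

/-- (a) The proportion of the ALWAYS-TRUE property is `1` whenever some curve of the family has naive
height `< X` (and the junk value `0` otherwise). -/
theorem heightProportion_true {X : ℕ} (hX : (heightFamilyBelow X).Nonempty) :
    heightProportion (fun _ => True) X = 1 := by
  have hc : ((heightFamilyBelow X).card : ℝ) ≠ 0 := by
    exact_mod_cast (Finset.card_pos.mpr hX).ne'
  simp [heightProportion, heightAverage, hc]

/-- (b, instance where the predicate HOLDS) Every property has height density at least `0`. -/
theorem heightDensityGE_zero (P : ℤ × ℤ → Prop) : HeightDensityGE P 0 := by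
  intro ε hε
  exact Eventually.of_forall fun X => by linarith [heightProportion_nonneg P X]

/-- (b, instance where the predicate FAILS) The empty property does not have positive height density:
`¬ HeightDensityGE (fun _ ↦ False) δ` for every `δ > 0`. -/
theorem not_heightDensityGE_false {δ : ℝ} (hδ : 0 < δ) : ¬ HeightDensityGE (fun _ => False) δ := by
  intro h
  have hev := h (δ / 2) (by linarith)
  obtain ⟨X, hX⟩ := hev.exists
  rw [heightProportion_false] at hX
  linarith

/-- (b) `HeightDensityGE` is monotone in the property: a larger set of curves has at least the same
density (used implicitly when reading "at least δ of curves satisfy P ∧ Q ⇒ at least δ satisfy P"). -/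
theorem HeightDensityGE.mono {P Q : ℤ × ℤ → Prop} {δ : ℝ} (h : HeightDensityGE P δ)
    (hPQ : ∀ AB, P AB → Q AB) : HeightDensityGE Q δ := by
  intro ε hε
  refine (h ε hε).mono fun X hX => le_trans hX ?_
  unfold heightProportion heightAverage
  refine div_le_div_of_nonneg_right (Finset.sum_le_sum fun AB _ => ?_) (Nat.cast_nonneg _)
  by_cases hP : P AB
  · simp [hP, hPQ AB hP]
  · by_cases hQ : Q AB <;> simp [hP, hQ]

end Summit.BirchSwinnertonDyer.BSDPercentage.Runbook
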